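import Summits.AtomisticToContinuum.FouriersLaw.Theorems.BondHeatUncertaintyBoundedResponseBathHeat
import Summits.AtomisticToContinuum.FouriersLaw.Theorems.BondHeatUncertaintyBoundedResponseTransientBand
import Summits.AtomisticToContinuum.FouriersLaw.Theorems.BondHeatUncertaintyBoundedResponseBathHeatLateTail
import HarnessLib

/-!
# BondHeatUncertainty / BoundedResponse — «DCBand» (lens-1 g117, NODE 117): the floor of the blocker re-cut at the Thouless FREQUENCY,
with the admittance sign `ŝ_N(ω) ≤ 2T²/γ` as the new free input

Target of record: `BoundedResponse` (stmt-AtomisticToContinuum-11071) `⟺ OhmicFloor` (`E_N ≤ C₁/N`).  Currency: the bath kinetic kernel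
`K_N = bathKinCorr = TransientBand.escapeKernel` (same term), `E_N = escapeDeficit`, `M_N(ω) = TransientBand.warburgDip` (the Warburg dip),
`W_N = deficitCesaro` (Cesàro deficit; `bathHeatVar = 2γT²·W_N`, §1), `c₁ = ∫_{(0,∞)} (1 − cos ω)/ω²`.

## The object
`spectralDeficit`: **`h_N(ω) := 1 − (γ/T²) ∫_{(0,∞)} cos(ωu) K_N(u) du`** — the escape deficit RESOLVED IN FREQUENCY.  `h_N(0) = E_N`
(`spectralDeficit_zero`); `h_N(ω) = E_N + M_N(ω)` (`spectralDeficit_eq_escapeDeficit_add_warburgDip`); `h_N ≤ 1` (Bochner, `spectralDeficit_le_one`);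
and `(2T²/γ)·h_N(ω) = 2T²/γ − ŝ_N(ω)` is the NOISE SPECTRUM OF THE BATH HEAT CURRENT (white thermostat noise minus kinetic feedback), i.e. the real
part of the thermal admittance of the contact.  ★ EXACT IDENTITY (§1, proved): **`c₁ · W_N(t) = ∫_{(0,∞)} (1 − cos ωt) ω⁻² h_N(ω) dω`** for every
`t ≥ 0` and every `N` (`deficitCesaro_eq_spectral`) — the Cesàro deficit / bath heat variance is the Fejér-smoothed heat-current spectrum; its
`(D)`-bound `W_N(cN²) = O(N)` therefore weighs `h_N` with mass `≈ t = cN²` concentrated on the THOULESS BAND `ω ≲ 1/(cN²)`.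

## The pieces (tags in the decl docstrings)
* **(FC) `SpectralDeficitNonneg`** — `h_N(ω) ≥ 0` for ALL `ω`, all `N ≥ 2`, all parameters (`⟺ ŝ_N(ω) ≤ 2T²/γ ⟺ M_N(ω) ≥ −E_N`): the FREE CEILING
  of the kinetic spectrum by the white bath level.  THEOREM-GRADE (classical, two proofs in the docstring: resolvent Cauchy–Schwarz on
  `p₀² − T = −γ⁻¹ S_bath(p₀²/2)`; or the `ω`-twisted Kundu–Dhar–Narayan heat-proxy variance) · NOT YET IN THE TREE (its `ω = 0` case is the tree
  theorem `escapeDeficit_nonneg`) · ATTACKABLE · carries NEW information (not implied by Bochner positivity of `K_N` plus `E_N ≥ 0`: a narrow spectral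
  line of `K_N` away from DC is Bochner-admissible and violates it).  ★ REDUCED (§6, `spectralDeficitNonneg_of_twistedHeatVarNonneg`, affine Fejér
  limit by dominated convergence) to **(TV) `TwistedHeatVarNonneg`**: `V_N(ω,t) := 2γT²t − 2γ²∫₀ᵗ(t − r)cos(ωr)K_N(r)dr ≥ 0` — THE VERBATIM `ω`-TWIST
  OF THE TREE THEOREM `bathHeatVar_nonneg` (NODE 107; `twistedHeatVarNonneg_zero`), i.e. `E|∫₀ᵗe^{iωs}dQ_s|² ≥ 0` for the bath heat proxy.
* **(BDF_θ) `BandDeficitFloor θ`** — `∀ c > 0 ∃ η N₀ ∀ N ≥ N₀ ∀ ω ∈ (0, 1/(cN²)]: h_N(ω) ≥ θ·E_N − η/N`: inside the Thouless band the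
  frequency-resolved deficit keeps the fraction `θ` of its DC value up to `O(1/N)` («no conductance dip finer than the Thouless frequency»).
  UNDECIDED · WEAKER than 11071 given (FC) (`bandDeficitFloor_of_ohmicFloor`, every `θ ≥ 0`) · ⟸ `WarburgDipFloor` (`θ ≤ 1`; hence ⟸ `WarburgDipNonneg`
  ⟸ `BoundaryDEP`, and ⟸ the kernel floor `BathKernelFloor 0 (3/2)` of NODE 107/108) · antitone in `θ` · TRUE in every transport regime heuristically
  (ballistic: `ŝ_N` is an autoconvolution of a nonnegative even function, maximal at DC by Cauchy–Schwarz, `η = 0`; localized: `h_N` analytic on the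
  band with `O(ω²N³) = O(1/N)` variation; diffusive: the claim).  THE LADDER IN `θ` (§5): `θ ≤ 0` FREE beneath (FC) · `0 < θ ≤ 1` THE RESIDUAL ·
  `θ > 1` COSTUME — `(BDF_{θ>1}) ⟹ OhmicFloor` outright by `ω → 0⁺` (`ohmicFloor_of_bandDeficitFloor_of_one_lt`; `h_N` continuous, `h_N(0) = E_N`).
* **THE DOOR** (`ohmicFloor_of_deficitCesaroPoint_bandDeficitFloor`): **(FC) ∧ (BDF_θ) ∧ (D) ⟹ OhmicFloor ⟺ 11071** for every `θ > 0`, where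
  (D) = `DeficitCesaroPoint` `⟸ BathHeatPoint 1 ⟸ (S)` (`deficitCesaroPoint_of_bathHeatPoint_one`, tree `bathHeatPoint_one_of_subdiffusiveBondHeat`).
  Mechanism: in the identity drop the off-band frequencies by (FC) (they only help), bound the Fejér weight below by `(43/96)t²` on the band
  (`Real.cos_bound`), get the FRACTIONAL Cesàro floor `c₁W_N(t) ≥ (43/96)·t·(θE_N − η/N)` (`deficitCesaro_ge_of_bandDeficitFloor`), and divide (D) by `t = cN²`.
  Versus the door of record 92T (`(D) ∧ TransientFloor 1`, floor hypothesis `WarburgDipFloor` on the whole infrared `|ω| ≤ 1` with a `√|ω|` modulus):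
  the MID BAND `1/(cN²) < ω ≤ 1` NOW NEEDS NO HYPOTHESIS — it is paid for by (FC) at the price of the factor `43θ/(96c₁)` of signal, which (D) absorbs.
  Versus the residual of record (BTᶠ_1)/`LateTailFloor a 1 1` (time side, weight `min(r,t)`): the band floor tolerates negative kernel mass `m` at lag
  `r ≪ t = cN²` up to `m ≲ (t/r)²·η/N` (weight `(1 − cos ωr) ≤ (r/t)²/2` on the band) instead of `m ≲ (t/r)/N` — quadratically, not linearly, blind
  to early lags; the two are incomparable as statements and coincide with 11071 beneath (FC) ∧ (D) (`boundedResponse_iff_bandDeficitFloor`).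
  MADE A THEOREM in §7: the weakest one-sided time-domain supplier **(BNM) `BandNegMass`** (`(γ/T²)∫min((r/cN²)²/2,2)K_N⁻ = O(1/N)`) gives (BDF_θ),
  `θ ≤ 1` (`bandDeficitFloor_of_bandNegMass`), and NODE 109's weakest one-sided supplier `LateNegMass a` of the residual of record gives (BNM) for EVERY
  slope `a > 0` (`bandNegMass_of_lateNegMass`: lags `r ≤ aN` are free, `min((r/t)²/2,2) ≤ (2/t)min(r,t)` beyond) — so every kernel / cumulant floor of
  NODEs 107–110 feeds the band door (`bandDeficitFloor_of_lateNegMass`), while (BNM) tolerates `O(1)` negative mass at lags `N ≪ r ≪ N²`.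

Also: `h_N` even and continuous (`spectralDeficit_neg`, `continuous_spectralDeficit`), `h_N(0) ≥ 0` is the tree's `E_N ≥ 0` (`spectralDeficit_zero_nonneg`),
`BathHeatPoint 1 ⟺ DeficitCesaroPoint` (`bathHeatPoint_one_iff_deficitCesaroPoint`: NODE 107's and NODE 92's Thouless-point ceilings are one statement).
0 sorry; tree-only imports (+ HarnessLib); no instance/notation/macro/private/set_option.  LANDING CUT (≤ 400 l): part A `…BathHeatDCBandA` = §0–§3
(object, ★ identity, pieces (FC)/(BDF_θ), engine; carries this overview), part B `…BathHeatDCBandB` = §4–§5 (doors, necessity, exactness, θ-ladder,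
saturation), main `…BathHeatDCBand` = §6–§7 ((TV) ⟹ (FC); (BNM) ⟹ (BDF_θ) ⟸ `LateNegMass a`); each imports the previous.
-/

noncomputable section

open MeasureTheory ProbabilityTheory Filter Topology Set Function
open scoped NNReal ENNReal
open Literature.MathematicalPhysics.KineticTheory.HeatConduction
open Literature.MathematicalPhysics.KineticTheory OscillatorChain
open Literature.Probability.Process
open Summit.AtomisticToContinuum.FouriersLaw.Theorems.SubdiffusiveBondHeat
open Summit.AtomisticToContinuum.FouriersLaw.Theorems.SubdiffusiveBondHeat.EscapeGrading
open Summit.AtomisticToContinuum.FouriersLaw.Theorems.OddSectorIrreversibility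

namespace Summit.AtomisticToContinuum.FouriersLaw.Theorems.BoundedResponse.HeatSpreading

open Summit.AtomisticToContinuum.FouriersLaw.Theorems.BoundedResponse.TransientContact
open Summit.AtomisticToContinuum.FouriersLaw.Theorems.BoundedResponse.TransientBand
open Summit.AtomisticToContinuum.FouriersLaw.Theses.BondHeatUncertainty (BoundedResponse SubdiffusiveBondHeat)
open Summit.AtomisticToContinuum.FouriersLaw.Theses.GriffithsLimitExchange (BoundaryDEP)

/-! ## §0 The object: the escape deficit resolved in frequency -/

/-- **`h_N(ω) := 1 − (γ/T²) ∫_{(0,∞)} cos(ωu) K_N(u) du`** — the frequency-resolved escape deficit; `(2T²/γ)·h_N` is the heat-current noise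
spectrum of the contact (white bath level `2T²/γ` minus the kinetic spectrum `ŝ_N(ω) = 2∫cos(ωu)K_N`).  `h_N(0) = E_N`. [formal bookkeeping; this cell] -/
def spectralDeficit (ω₂ lam β γ T : ℝ) (N : ℕ) (ω : ℝ) : ℝ :=
  1 - γ / T ^ 2 * ∫ u in Ioi (0 : ℝ), Real.cos (ω * u) * bathKinCorr ω₂ lam β γ T N u

/-- The two kernel names of the lineage denote the same term. [formal bookkeeping] -/
theorem bathKinCorr_eq_escapeKernel (ω₂ lam β γ T : ℝ) (N : ℕ) :
    bathKinCorr ω₂ lam β γ T N = escapeKernel ω₂ lam β γ T N := rfl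

/-- `h_N(0) = E_N`. [formal bookkeeping] -/
theorem spectralDeficit_zero (ω₂ lam β γ T : ℝ) (N : ℕ) :
    spectralDeficit ω₂ lam β γ T N 0 = escapeDeficit ω₂ lam β γ T N := by
  simp only [spectralDeficit, zero_mul, Real.cos_zero, one_mul, escapeDeficit_eq_bathKinCorr]

/-- The `ω = 0` instance of (FC) is the tree theorem `E_N ≥ 0` (`N ≥ 2`). [tree: `escapeDeficit_nonneg'`] -/
theorem spectralDeficit_zero_nonneg {ω₂ lam β γ : ℝ} (hω : 0 < ω₂) (hl : 0 < lam) (hβ : 0 < β) (hγ : 0 < γ) {T : ℝ} (hT : 0 < T)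
    {N : ℕ} (hN : 2 ≤ N) : 0 ≤ spectralDeficit ω₂ lam β γ T N 0 := by
  rw [spectralDeficit_zero]; exact escapeDeficit_nonneg' hω hl hβ hγ hT hN

/-- `h_N` is even in the frequency. [formal bookkeeping] -/
theorem spectralDeficit_neg (ω₂ lam β γ T : ℝ) (N : ℕ) (ω : ℝ) :
    spectralDeficit ω₂ lam β γ T N (-ω) = spectralDeficit ω₂ lam β γ T N ω := by
  simp only [spectralDeficit, neg_mul, Real.cos_neg]

section FixedN

variable {ω₂ lam β γ : ℝ} (hω : 0 < ω₂) (hl : 0 < lam) (hβ : 0 < β) (hγ : 0 < γ) {T : ℝ} (hT : 0 < T)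
include hω hl hβ hγ hT

/-- **`h_N(ω) = E_N + M_N(ω)`** (every `N`): DC deficit plus Warburg dip. [folklore] -/
theorem spectralDeficit_eq_escapeDeficit_add_warburgDip (N : ℕ) (ω : ℝ) :
    spectralDeficit ω₂ lam β γ T N ω = escapeDeficit ω₂ lam β γ T N + warburgDip ω₂ lam β γ T N ω := by
  have hKi := integrableOn_escapeKernel hω hl hβ hγ hT N
  rw [spectralDeficit, escapeDeficit_eq_bathKinCorr, warburgDip, bathKinCorr_eq_escapeKernel,
    dip_eq_sub_cosTransform hKi ω]
  ring

/-- **`h_N(ω) ≤ 1`** (every `N`, `ω`): Bochner positivity of the kinetic spectrum `∫cos(ωu)K_N ≥ 0`. [folklore] -/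
theorem spectralDeficit_le_one (N : ℕ) (ω : ℝ) : spectralDeficit ω₂ lam β γ T N ω ≤ 1 := by
  have hC : 0 ≤ ∫ u in Ioi (0 : ℝ), Real.cos (ω * u) * bathKinCorr ω₂ lam β γ T N u := by
    rw [bathKinCorr_eq_escapeKernel]
    exact cosTransform_nonneg_of_lagIntegral_nonneg (hKi := integrableOn_escapeKernel hω hl hβ hγ hT N)
      (continuous_escapeKernel hω hl hβ hγ hT N).measurable (abs_escapeKernel_le hω hl hβ hγ hT N)
      (fun ω' t ht => escapeKernel_lagIntegral_cos_nonneg hω hl hβ hγ hT N ω' ht) ω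
  have : 0 ≤ γ / T ^ 2 * ∫ u in Ioi (0 : ℝ), Real.cos (ω * u) * bathKinCorr ω₂ lam β γ T N u :=
    mul_nonneg (by positivity) hC
  rw [spectralDeficit]; linarith

/-- `ω ↦ h_N(ω)` is continuous (every `N`; dominated convergence, `|cos(ωu)K_N(u)| ≤ |K_N(u)| ∈ L¹`). [folklore] -/
theorem continuous_spectralDeficit (N : ℕ) : Continuous fun ω : ℝ => spectralDeficit ω₂ lam β γ T N ω := by
  have hKc := continuous_escapeKernel hω hl hβ hγ hT N
  have hKi := integrableOn_escapeKernel hω hl hβ hγ hT N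
  have hI : Continuous fun ω : ℝ => ∫ u in Ioi (0 : ℝ), Real.cos (ω * u) * escapeKernel ω₂ lam β γ T N u := by
    refine continuous_of_dominated (bound := fun u => ‖escapeKernel ω₂ lam β γ T N u‖) ?_ ?_ hKi.norm ?_
    · intro ω
      exact ((Real.continuous_cos.comp (continuous_const.mul continuous_id)).mul hKc).aestronglyMeasurable
    · intro ω
      refine ae_of_all _ (fun u => ?_)
      rw [norm_mul]
      exact mul_le_of_le_one_left (norm_nonneg _) (by rw [Real.norm_eq_abs]; exact Real.abs_cos_le_one _)
    · exact ae_of_all _ (fun u => (Real.continuous_cos.comp (continuous_id.mul continuous_const)).mul continuous_const)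
  have h2 : Continuous fun ω : ℝ => 1 - γ / T ^ 2 * ∫ u in Ioi (0 : ℝ), Real.cos (ω * u) * escapeKernel ω₂ lam β γ T N u :=
    continuous_const.sub (continuous_const.mul hI)
  simpa only [spectralDeficit, bathKinCorr_eq_escapeKernel] using h2

/-- The Fejér-weighted spectral deficit is integrable on `(0,∞)` (`t ≥ 0`, every `N`). [folklore] -/
theorem integrableOn_fejer_mul_spectralDeficit (N : ℕ) {t : ℝ} (ht : 0 ≤ t) :
    IntegrableOn (fun ω : ℝ => (1 - Real.cos (ω * t)) / ω ^ 2 * spectralDeficit ω₂ lam β γ T N ω) (Ioi 0) := by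
  have hKm := (continuous_escapeKernel hω hl hβ hγ hT N).measurable
  have hKi := integrableOn_escapeKernel hω hl hβ hγ hT N
  have h1 : IntegrableOn (fun ω : ℝ => (1 - Real.cos (ω * t)) / ω ^ 2 * escapeDeficit ω₂ lam β γ T N) (Ioi 0) :=
    (integrableOn_one_sub_cos_mul_div_sq ht).mul_const _
  have h2 : IntegrableOn (fun ω : ℝ => (1 - Real.cos (ω * t)) / ω ^ 2 * warburgDip ω₂ lam β γ T N ω) (Ioi 0) := by
    have h : IntegrableOn (fun ω : ℝ => γ / T ^ 2 * ((1 - Real.cos (ω * t)) / ω ^ 2 *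
        ∫ u in Ioi 0, (1 - Real.cos (ω * u)) * escapeKernel ω₂ lam β γ T N u)) (Ioi 0) :=
      (integrableOn_spectralIntegrand hKm hKi ht).const_mul (γ / T ^ 2)
    refine h.congr_fun (fun ω _ => ?_) measurableSet_Ioi
    unfold warburgDip
    ring
  refine (h1.add h2).congr_fun (fun ω _ => ?_) measurableSet_Ioi
  simp only [Pi.add_apply]
  rw [spectralDeficit_eq_escapeDeficit_add_warburgDip hω hl hβ hγ hT N ω]; ring

/-! ## §1 ★ The Cesàro deficit / bath heat variance IS the Fejér-smoothed heat-current spectrum -/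

/-- ★ **`c₁ · W_N(t) = ∫_{(0,∞)} (1 − cos ωt) ω⁻² h_N(ω) dω`** for `t ≥ 0` and every `N`
(`W_N = deficitCesaro`; `W_N = tE_N + Ov_N`, `c₁Ov_N = ∫(1 − cos ωt)ω⁻²M_N`, `∫(1 − cos ωt)ω⁻² = c₁t`, `h_N = E_N + M_N`). [this cell] -/
theorem deficitCesaro_eq_spectral (N : ℕ) {t : ℝ} (ht : 0 ≤ t) :
    (∫ ω in Ioi (0 : ℝ), (1 - Real.cos ω) / ω ^ 2) * deficitCesaro ω₂ lam β γ T N t =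
      ∫ ω in Ioi (0 : ℝ), (1 - Real.cos (ω * t)) / ω ^ 2 * spectralDeficit ω₂ lam β γ T N ω := by
  have hKm := (continuous_escapeKernel hω hl hβ hγ hT N).measurable
  have hKi := integrableOn_escapeKernel hω hl hβ hγ hT N
  have h1 : IntegrableOn (fun ω : ℝ => (1 - Real.cos (ω * t)) / ω ^ 2 * escapeDeficit ω₂ lam β γ T N) (Ioi 0) :=
    (integrableOn_one_sub_cos_mul_div_sq ht).mul_const _
  have h2 : IntegrableOn (fun ω : ℝ => (1 - Real.cos (ω * t)) / ω ^ 2 * warburgDip ω₂ lam β γ T N ω) (Ioi 0) := by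
    have h : IntegrableOn (fun ω : ℝ => γ / T ^ 2 * ((1 - Real.cos (ω * t)) / ω ^ 2 *
        ∫ u in Ioi 0, (1 - Real.cos (ω * u)) * escapeKernel ω₂ lam β γ T N u)) (Ioi 0) :=
      (integrableOn_spectralIntegrand hKm hKi ht).const_mul (γ / T ^ 2)
    refine h.congr_fun (fun ω _ => ?_) measurableSet_Ioi
    unfold warburgDip
    ring
  have hsplit : (fun ω : ℝ => (1 - Real.cos (ω * t)) / ω ^ 2 * spectralDeficit ω₂ lam β γ T N ω) =
      fun ω => (1 - Real.cos (ω * t)) / ω ^ 2 * escapeDeficit ω₂ lam β γ T N +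
        (1 - Real.cos (ω * t)) / ω ^ 2 * warburgDip ω₂ lam β γ T N ω := by
    funext ω
    rw [spectralDeficit_eq_escapeDeficit_add_warburgDip hω hl hβ hγ hT N ω, mul_add]
  rw [hsplit, integral_add h1 h2, integral_mul_const, integral_one_sub_cos_mul_div_sq ht,
    ← escapeTransient_eq_spectral hω hl hβ hγ hT N ht, deficitCesaro_eq_add hω hl hβ hγ hT N ht]
  ring

/-- **`bathHeatVar = 2γT² · deficitCesaro`** (`N ≥ 1`, `t ≥ 0`): the bath heat variance of NODE 107 and the Cesàro deficit of NODE 92 are ONE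
functional (both Einstein–Helfand identities; `bathTail = γT²·escapeTransient` termwise). [this cell] -/
theorem bathHeatVar_eq_deficitCesaro {N : ℕ} (hN : 0 < N) {t : ℝ} (ht : 0 ≤ t) :
    bathHeatVar ω₂ lam β γ T N t = 2 * γ * T ^ 2 * deficitCesaro ω₂ lam β γ T N t := by
  have h1 := bathHeatVar_eq_escapeDeficit_add_bathTail hω hl hβ hγ hT hN ht
  have h2 := deficitCesaro_eq_add hω hl hβ hγ hT N ht
  have h3 : bathTail ω₂ lam β γ T N t = γ * T ^ 2 * escapeTransient ω₂ lam β γ T N t := by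
    have hT2 : T ^ 2 ≠ 0 := by positivity
    simp only [bathTail, escapeTransient, bathKinCorr_eq_escapeKernel]
    field_simp
  rw [h1, h2, h3]; ring

/-- ★ **`c₁ · bathHeatVar_N(t) = 2γT² ∫_{(0,∞)} (1 − cos ωt) ω⁻² h_N(ω) dω`** (`N ≥ 1`, `t ≥ 0`): the bath heat variance is the
Fejér-smoothed heat-current noise spectrum (Wiener–Khinchin for the stationary-increment heat process, at the kernel level). [this cell] -/
theorem bathHeatVar_eq_spectral {N : ℕ} (hN : 0 < N) {t : ℝ} (ht : 0 ≤ t) :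
    (∫ ω in Ioi (0 : ℝ), (1 - Real.cos ω) / ω ^ 2) * bathHeatVar ω₂ lam β γ T N t =
      2 * γ * T ^ 2 * ∫ ω in Ioi (0 : ℝ), (1 - Real.cos (ω * t)) / ω ^ 2 * spectralDeficit ω₂ lam β γ T N ω := by
  rw [bathHeatVar_eq_deficitCesaro hω hl hβ hγ hT hN ht, ← deficitCesaro_eq_spectral hω hl hβ hγ hT N ht]; ring

end FixedN

/-! ## §2 The pieces -/

/-- **(FC) `SpectralDeficitNonneg`** — «the kinetic spectrum never exceeds the white bath level»: `h_N(ω) ≥ 0` for all parameters, `T > 0`, every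
`N ≥ 2` and every `ω` (`⟺ ŝ_N(ω) = 2∫cos(ωu)K_N ≤ 2T²/γ ⟺ M_N(ω) ≥ −E_N`, `neg_escapeDeficit_le_warburgDip_of_spectralDeficitNonneg`); ⟸ (TV) of §6,
the `ω`-twist of the tree's `bathHeatVar_nonneg` (`spectralDeficitNonneg_of_twistedHeatVarNonneg`).
Tags: THEOREM-GRADE · ATTACKABLE (provable now) · NOT in the tree (its `ω = 0` instance is the tree theorem `escapeDeficit_nonneg`).  Proof 1 (resolvent,
five lines on paper): with `S = γ(T∂²_{p₀} − p₀∂_{p₀})` the left thermostat, `A := p₀² − T = −γ⁻¹S f₀`, `f₀ = p₀²/2`, and `h = (iω − L)⁻¹A`,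
`∫₀^∞cos(ωu)K_N = Re⟨h, A⟩ = ⟨h, −S_tot h⟩ =: 𝒟(h)` (the Liouville and `iω` parts are skew), while `|⟨h, A⟩| = γ⁻¹|ℰ_L(h, f₀)| ≤ γ⁻¹𝒟(h)^{1/2}(γT²)^{1/2}`
(Cauchy–Schwarz in the Dirichlet form, `ℰ_L(f₀,f₀) = γT·E p₀² = γT²`); hence `𝒟(h) ≤ T²/γ`.  It even gives the EXACT representation
`h_N(ω) = T⁻¹‖p₀ − γ∂_{p₀}h_ω‖²_{L²(μ_T)} + γT⁻¹‖∂_{p_{N−1}}h_ω‖²` (`N ≥ 2`).  Proof 2 (path space, the tree's technology): the `ω`-twisted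
Kundu–Dhar–Narayan identity `E|∫₀ᵗ e^{iωs} dQ^L_s|² = 2γT²t − 2γ²∫₀ᵗ(t − r)cos(ωr)K_N(r)dr ≥ 0` for the heat proxy of `pinnedChain_heatProxy_sq_eq`, then
Fejér `t → ∞` as in `cosTransform_nonneg_of_lagIntegral_nonneg`.  Content: NOT implied by Bochner positivity of `K_N` and `E_N ≥ 0` (a kernel
`2T²cos(ω₀u)e^{−εu}` is positive-definite with small DC mass and violates it at `ω₀`): it encodes that `p₀² − T` is a thermostat coboundary.
Why it might fail: it cannot (theorem); the risk is only formalization cost (est. 400–600 lines). (piece · free ceiling) [classical; this cell] -/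
def SpectralDeficitNonneg : Prop :=
  ∀ ω₂ lam β γ : ℝ, 0 < ω₂ → 0 < lam → 0 < β → 0 < γ → ∀ T : ℝ, 0 < T → ∀ N : ℕ, 2 ≤ N → ∀ ω : ℝ,
    0 ≤ spectralDeficit ω₂ lam β γ T N ω

/-- **(BDF_θ) `BandDeficitFloor θ`** — the DEFICIT FLOOR ON THE THOULESS BAND at fraction `θ`:
`∀ c > 0 ∃ η N₀ ∀ N ≥ N₀ ∀ ω > 0, ω·cN² ≤ 1 → h_N(ω) ≥ θ·E_N − η/N` («inside the Thouless band the frequency-resolved deficit keeps the fraction `θ`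
of its DC value, up to `O(1/N)`»; at `θ = 1`: `ŝ_N(ω) ≤ ŝ_N(0) + (2T²/γ)η/N` there — no dip of the heat conductance finer than the Thouless frequency).
Tags: UNDECIDED · WEAKER than 11071 given (FC) (`bandDeficitFloor_of_ohmicFloor`, all `θ ≥ 0`) · with (FC) ∧ (D) EQUIVALENT to 11071 for every `θ > 0`
(`boundedResponse_iff_bandDeficitFloor`) · ⟸ `WarburgDipFloor` for `θ ≤ 1` (`bandDeficitFloor_of_warburgDipFloor`; so ⟸ `WarburgDipNonneg` ⟸ `BoundaryDEP`)
· antitone in `θ` (`bandDeficitFloor_anti`) · `θ ≤ 0` free given (FC) · INSTRUMENTABLE (one cosine transform of the census kernel at `ω ≤ 1/(cN²)`).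
Why it might fail: a RESONANT RETURN — kinetic memory mass of size `≳ 1/N` returning to the contact at lags `≳ cN²` with NEGATIVE sign (anti-correlated
late echo off the far bath) would push `ŝ_N` above its DC value inside the band; early lags `r ≪ cN²` cannot (weight `(r/cN²)²`).
(piece · rung, graded by `θ`) [route statement · this cell; NOT a literature fact] -/
def BandDeficitFloor (θ : ℝ) : Prop :=
  ∀ ω₂ lam β γ : ℝ, 0 < ω₂ → 0 < lam → 0 < β → 0 < γ → ∀ T : ℝ, 0 < T → ∀ c : ℝ, 0 < c →
    ∃ η : ℝ, ∃ N₀ : ℕ, ∀ N : ℕ, N₀ ≤ N → ∀ ω : ℝ, 0 < ω → ω * (c * (N : ℝ) ^ 2) ≤ 1 →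
      θ * escapeDeficit ω₂ lam β γ T N - η / (N : ℝ) ≤ spectralDeficit ω₂ lam β γ T N ω

/-! ## §3 The engine: a band floor under a free sign gives a fractional Fejér mass -/

/-- `1 − cos x ≥ (43/96)·x²` for `|x| ≤ 1` (`Real.cos_bound`). [folklore] -/
theorem sq_mul_le_one_sub_cos {x : ℝ} (hx : |x| ≤ 1) : 43 / 96 * x ^ 2 ≤ 1 - Real.cos x := by
  have h := Real.cos_bound hx
  have h4 : |x| ^ 4 ≤ x ^ 2 := by
    have hx2 : |x| ^ 2 ≤ 1 := by nlinarith [abs_nonneg x]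
    calc |x| ^ 4 = |x| ^ 2 * |x| ^ 2 := by ring
      _ ≤ |x| ^ 2 * 1 := mul_le_mul_of_nonneg_left hx2 (sq_nonneg _)
      _ = x ^ 2 := by rw [mul_one, sq_abs]
  have h' : Real.cos x - (1 - x ^ 2 / 2) ≤ x ^ 2 * (5 / 96) :=
    (le_abs_self _).trans (h.trans (by nlinarith))
  linarith

/-- The Fejér weight on the band: `ω > 0`, `ωt ≤ 1`, `t ≥ 0` ⟹ `(1 − cos ωt)/ω² ≥ (43/96)t²`. [folklore] -/
theorem fejerWeight_ge_on_band {ω t : ℝ} (hω : 0 < ω) (ht : 0 ≤ t) (hωt : ω * t ≤ 1) :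
    43 / 96 * t ^ 2 ≤ (1 - Real.cos (ω * t)) / ω ^ 2 := by
  have habs : |ω * t| ≤ 1 := by rw [abs_of_nonneg (mul_nonneg hω.le ht)]; exact hωt
  have h := sq_mul_le_one_sub_cos habs
  rw [le_div_iff₀ (pow_pos hω 2)]
  calc 43 / 96 * t ^ 2 * ω ^ 2 = 43 / 96 * (ω * t) ^ 2 := by ring
    _ ≤ 1 - Real.cos (ω * t) := h

/-- ★ **ENGINE.**  If `g ≥ 0` on `(0,∞)` (free sign), `g ≥ m ≥ 0` on the band `{0 < ω, ωt ≤ 1}` and the Fejér-weighted `g` is integrable, then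
`∫_{(0,∞)} (1 − cos ωt) ω⁻² g(ω) dω ≥ (43/96)·m·t` (`t > 0`): drop the off-band part, keep `(43/96)t²` of weight on a band of length `1/t`. [this cell] -/
theorem integral_fejer_mul_ge_of_bandFloor {g : ℝ → ℝ} {t m : ℝ} (ht : 0 < t) (hm : 0 ≤ m)
    (hgi : IntegrableOn (fun ω : ℝ => (1 - Real.cos (ω * t)) / ω ^ 2 * g ω) (Ioi 0))
    (hpos : ∀ ω : ℝ, 0 < ω → 0 ≤ g ω) (hband : ∀ ω : ℝ, 0 < ω → ω * t ≤ 1 → m ≤ g ω) :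
    43 / 96 * m * t ≤ ∫ ω in Ioi (0 : ℝ), (1 - Real.cos (ω * t)) / ω ^ 2 * g ω := by
  set ℓ : ℝ → ℝ := (Ioc (0 : ℝ) t⁻¹).indicator (fun _ => 43 / 96 * t ^ 2 * m) with hℓ
  have hℓi : IntegrableOn ℓ (Ioi 0) := by
    refine Integrable.integrableOn ?_
    refine (integrable_indicator_iff measurableSet_Ioc).2 (integrableOn_const (hs := ?_))
    simp [Real.volume_Ioc]
  have hℓint : ∫ ω in Ioi 0, ℓ ω = 43 / 96 * m * t := by
    rw [hℓ, setIntegral_indicator measurableSet_Ioc, inter_eq_right.2 Ioc_subset_Ioi_self, setIntegral_const,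
      Real.volume_real_Ioc_of_le (inv_nonneg.2 ht.le), sub_zero, smul_eq_mul]
    field_simp
  have hpt : ∀ ω ∈ Ioi (0 : ℝ), ℓ ω ≤ (1 - Real.cos (ω * t)) / ω ^ 2 * g ω := by
    intro ω hω
    have hω : (0 : ℝ) < ω := hω
    by_cases hb : ω ∈ Ioc (0 : ℝ) t⁻¹
    · have hωt : ω * t ≤ 1 := by
        have := mul_le_mul_of_nonneg_right hb.2 ht.le
        rwa [inv_mul_cancel₀ ht.ne'] at this
      rw [hℓ, indicator_of_mem hb]
      calc 43 / 96 * t ^ 2 * m ≤ (1 - Real.cos (ω * t)) / ω ^ 2 * m :=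
            mul_le_mul_of_nonneg_right (fejerWeight_ge_on_band hω ht.le hωt) hm
        _ ≤ (1 - Real.cos (ω * t)) / ω ^ 2 * g ω :=
            mul_le_mul_of_nonneg_left (hband ω hω hωt) (div_nonneg (one_sub_cos_mem_Icc (ω * t)).1 (sq_nonneg _))
    · rw [hℓ, indicator_of_notMem hb]
      exact mul_nonneg (div_nonneg (one_sub_cos_mem_Icc (ω * t)).1 (sq_nonneg _)) (hpos ω hω)
  have hmono := setIntegral_mono_on hℓi hgi measurableSet_Ioi hpt
  rwa [hℓint] at hmono

end Summit.AtomisticToContinuum.FouriersLaw.Theorems.BoundedResponse.HeatSpreading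

end
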